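import Summits.BirchSwinnertonDyer.BirchSwinnertonDyer.Theses.PrintX6
import Summits.BirchSwinnertonDyer.BirchSwinnertonDyer.Theorems.PrintX6EisensteinHalfSignedDescent
import HarnessLib

/-!
# Crux `PrintX6.EisensteinHalfAtThree` (stmt-BirchSwinnertonDyer-20285) — line 5dafa6f9 (birth skeleton rev 2,
# planner-bsd-print-x6-plan-g1, sha 5dafa6f969ed…), OWNED by the lead prover-bsd-line-x6-p1-0

Composition: `EisensteinHalfAtThree_of (hPub : PublishedInputsX6) : EisensteinHalfAtThree` from
* `stub_signedLowerDivisibilityAtThree` — OPEN (the declared residual: Kobayashi's Eisenstein/lower signed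
  divisibility for ONE sign at `p = 3`, `a₃ = 0`, on X6 ∧ ¬CM ∧ r_an = 0; = the `p = 3`, rank-0 slice of K3's
  crux `SignedLowerHalves.KobayashiLowerHalfSemistable`, stmt-19000, bridge
  `PrintX6.stub_signedLowerDivisibilityAtThree_of_kobayashiLowerHalfSemistable`, p541401);
* `stub_signedDescentRankZero` — CLOSED in the kernel by `PrintX6.signedDescentRankZero_of_inputs` (p535256).
-/

set_option autoImplicit false
set_option linter.dupNamespace false

noncomputable section

open scoped Classical

open Summit.BirchSwinnertonDyer.BirchSwinnertonDyer.Theses.PrintX6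

namespace Summit.BirchSwinnertonDyer.BirchSwinnertonDyer.Theorems.PrintX6.EisensteinHalfAtThreeLine

/-- **Stub 1 (OPEN — the residual).** Registered signature verbatim. [cite: Kobayashi2003, Conjecture (p. 2)] -/
theorem stub_signedLowerDivisibilityAtThree :
    ∀ (W : WeierstrassCurve ℚ) [W.IsElliptic] [W.IsGloballyMinimal] (p : ℕ) [Fact p.Prime],
      ¬ W.HasCM → p = 3 → Literature.NumberTheory.EllipticCurves.Rank1Residual.ClassX6 W p →
      W.analyticRank = 0 →
      ∃ ε : ℤˣ, Summit.BirchSwinnertonDyer.Rank1Residual.Supersingular.KobayashiLowerDivisibility W p ε := by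
  sorry

/-- **Stub 2 (CLOSED, p535256).** Registered signature verbatim; proof = the landed theorem
`PrintX6.signedDescentRankZero_of_inputs`. [cite: Kobayashi2003, Thm. 1.2 and (3.6)] [cite: BDKim2013, Cor. 3.15] -/
theorem stub_signedDescentRankZero :
    Summit.BirchSwinnertonDyer.BirchSwinnertonDyer.Theses.PrintX6.PublishedInputsX6 →
    ∀ (W : WeierstrassCurve ℚ) [W.IsElliptic] [W.IsGloballyMinimal] (p : ℕ) [Fact p.Prime],
      p ≠ 2 → Literature.NumberTheory.EllipticCurves.Rank1Residual.ClassX6 W p → W.analyticRank = 0 →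
      (∃ ε : ℤˣ, Summit.BirchSwinnertonDyer.Rank1Residual.Supersingular.KobayashiLowerDivisibility W p ε) →
      ∀ q : ℚ, Literature.NumberTheory.EllipticCurves.shaAn W = (q : ℂ) → padicValRat p q ≠ 0 →
        padicValRat p q ≤ (padicValNat p W.shaOrder : ℤ) :=
  Summit.BirchSwinnertonDyer.BirchSwinnertonDyer.Theorems.PrintX6.signedDescentRankZero_of_inputs

/-- **Composition**: the crux BY NAME from the two stubs, modulo the route's published inputs. -/
theorem EisensteinHalfAtThree_of (hPub : PublishedInputsX6) :
    Summit.BirchSwinnertonDyer.BirchSwinnertonDyer.Theses.PrintX6.EisensteinHalfAtThree := by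
  unfold Summit.BirchSwinnertonDyer.BirchSwinnertonDyer.Theses.PrintX6.EisensteinHalfAtThree
  intro W _ _ p _ hcm hp3 hX hr q hq hv
  exact stub_signedDescentRankZero hPub W p (by omega) hX hr
    (stub_signedLowerDivisibilityAtThree W p hcm hp3 hX hr) q hq hv

end Summit.BirchSwinnertonDyer.BirchSwinnertonDyer.Theorems.PrintX6.EisensteinHalfAtThreeLine

end
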